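import Mathlib
import Summits.MatrixMultiplication.MatrixMultiplication.Theorems.SnSubsetDichotomyNoThresholdSubsetTriplePlancherelStepDefs
import Summits.MatrixMultiplication.MatrixMultiplication.Theorems.SnSubsetDichotomyNoThresholdSubsetTripleTransProbSum

/-!
# `SnSubsetDichotomy.NoThresholdSubsetTriple`, line `klr-graded-polynomial-method`:
# stub `condVar_le_of_sq_change` ((L3) from (L2′): the conditional variance bound)

Write `q(ν) = Σ_{y addable} p_y x_y²` (`PlancherelStep.sqEnergy`) and `Δ_z q = q(ν ∪ z) - q(ν)` for an
addable node `z` of the Young diagram `ν`.  Assuming the square-root increment bound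
(L2′) `|Δ_z q| ≤ 6 √q + 11/3` at every corner `z`, the conditional second moment of the increment of `q`
under one Plancherel step is at most linear in `q`:
`Σ_z p_z (Δ_z q)² ≤ 72 q + 32`.

Proof.  Termwise, `(Δ_z q)² = |Δ_z q|² ≤ (6 √q + 11/3)² = 36 q + 44 √q + 121/9 ≤ 72 q + 32`
(since `36 q - 44 √q + 167/9 = 36 (√q - 11/18)² + 46/9 ≥ 0`); then sum against the probability weights
`p_z ≥ 0` (`PlancherelStep.transProb_nonneg`), which sum to one (`transProb_sum_eq_one`,
Greene–Nijenhuis–Wilf).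
-/

open scoped BigOperators
open Literature.RepresentationTheory.FiniteGroups (addableNodes IsAddableNode)

namespace Summit.MatrixMultiplication.MatrixMultiplication.Theorems

open PlancherelStep

set_option linter.dupNamespace false in -- deliberate Summit.<S>.<P> duplicate
/-- Termwise step: if `|d| ≤ 6 √q + 11/3` with `q ≥ 0`, then `d² ≤ 72 q + 32`
(`(6 √q + 11/3)² = 36 q + 44 √q + 121/9` and `36 q - 44 √q + 167/9 = 36 (√q - 11/18)² + 46/9 ≥ 0`).
[folklore] -/
private theorem sq_le_of_abs_le_sqrt {d q : ℝ} (hq : 0 ≤ q)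
    (h : |d| ≤ 6 * Real.sqrt q + 11 / 3) : d ^ 2 ≤ 72 * q + 32 := by
  have hs : Real.sqrt q ^ 2 = q := Real.sq_sqrt hq
  have hs0 : 0 ≤ Real.sqrt q := Real.sqrt_nonneg q
  have ha : 0 ≤ |d| := abs_nonneg d
  have h2 : |d| ^ 2 ≤ (6 * Real.sqrt q + 11 / 3) ^ 2 := pow_le_pow_left₀ ha h 2
  rw [sq_abs] at h2
  nlinarith [h2, sq_nonneg (Real.sqrt q - 11 / 18), hs, hs0]

set_option linter.dupNamespace false in -- deliberate Summit.<S>.<P> duplicate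
/-- **(L3) from (L2′): conditional variance bound for the energy `q` under one Plancherel step.**
If every corner `z` of every Young diagram `ν` satisfies the square-root increment bound
`|q(ν ∪ z) - q(ν)| ≤ 6 √q(ν) + 11/3`, then `Σ_{z addable} p_z (q(ν ∪ z) - q(ν))² ≤ 72 q(ν) + 32`:
square the termwise bound (`(6 √q + 11/3)² ≤ 72 q + 32`) and average against the transition
probabilities, which are nonnegative and sum to one (`transProb_sum_eq_one`). [folklore] -/
theorem condVar_le_of_sq_change :
    (∀ (ν : Finset (ℕ × ℕ)), IsLowerSet (ν : Set (ℕ × ℕ)) → ∀ (z : ℕ × ℕ), z ∈ addableNodes ν →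
      |sqEnergy (insert z ν) - sqEnergy ν| ≤ 6 * Real.sqrt (sqEnergy ν) + 11 / 3) →
    ∀ (ν : Finset (ℕ × ℕ)), IsLowerSet (ν : Set (ℕ × ℕ)) →
      ∑ z ∈ addableNodes ν, transProb ν z * (sqEnergy (insert z ν) - sqEnergy ν) ^ 2 ≤
        72 * sqEnergy ν + 32 := by
  intro h ν hν
  have hq : 0 ≤ sqEnergy ν := sqEnergy_nonneg ν
  calc ∑ z ∈ addableNodes ν, transProb ν z * (sqEnergy (insert z ν) - sqEnergy ν) ^ 2
      ≤ ∑ z ∈ addableNodes ν, transProb ν z * (72 * sqEnergy ν + 32) :=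
        Finset.sum_le_sum fun z hz =>
          mul_le_mul_of_nonneg_left (sq_le_of_abs_le_sqrt hq (h ν hν z hz)) (transProb_nonneg ν z)
    _ = 72 * sqEnergy ν + 32 := by
        rw [← Finset.sum_mul, transProb_sum_eq_one ν hν, one_mul]

end Summit.MatrixMultiplication.MatrixMultiplication.Theorems
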